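import Summits.QuantumFields.YangMills.Theorems.BalabanUVNodesN15KingModelFullPropagatorRate

/-!
# BalabanUVNodes ∕ N15 — THE KING-MODEL RUNG, CURVED EDITION (PART P): THE FULL `A = 0` FLUCTUATION PROPAGATOR AS AN OPERATOR —
# the two-spacing η-rate in King's ∕ Bałaban's OWN sup-norm currency ((3.7) ∕ [Ba 4] (1.10)): for EVERY bounded source, NO off-diagonal
# restriction, uniformly in the number of levels — `|Σ_{y′} η′^{d+1}[G^{η′}_{K+n}(x′, y′) − G^η_K(x, y)]f′(y′)| ≤ C·(L^{−γ∕2})^K·‖f′‖_∞`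
# (Track A, DAG node N15 = NE2; FAN-OUT v1.1 §N15 s3 «KING-MODEL RUNG … + the one-line statement of what the curved case adds»)

HONEST FRAMING.  Count-neutral kernel bookkeeping (cell `pub-ymgap`, seat `pub-ymgap-dag-n15-e` g6; `--supports stmt-QuantumFields-19912
--as helper` = K3‴ `SpineGivenEndpointR13`, lineage K3 19676 → K3′ 19908).  TEMPLATE LITERATURE, `A = 0`: C. King's scalar U(1)-Higgs MODEL
on finite tori ([King1986] (2.13)–(2.17) p. 653, (2.20) p. 654, Theorem 3.3 (3.7) p. 658 («|(G_k(A) f)(x)| ≤ C exp[−δ₀ dist(x, supp f)]‖f‖»,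
= [Ba 4] (1.10)), Prop. 3.8 (3.71) p. 664, p. 664 «x′ ∈ B^n(x)», §4 p. 675 (4.42)–(4.43); B4 p. 582 (2.39): each slice «rescaled to the
L^{−j}-lattice» carries a power of `L^jη`), NOT Bałaban's covariant objects; the statement below is the (2.17)-summed SHAPE of (3.7) + (3.71),
not a printed proposition; NE2⁺ is NOT PRINTED for those and not proved here; NOT a node discharge; nothing continuum ∕ ℝ⁴ ∕ OS ∕ mass-gap ∕
Clay.  0 `sorry`, 0 `def`, standard axioms.

THE POINT.  Parts O-a∕O-b are ENTRYWISE statements about `G(K, M, m²) = constrainedProp (L^K) M (aK a L K) ((L^K)²) m² = (L^K)^{d+1}·A₀⁻¹`,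
hence off-diagonal only (part O-c: the diagonal grows like `(L^{d−1})^K`).  In the printed OPERATOR form `(A₀⁻¹f)(x) = (L^K)^{−(d+1)}Σ_y G(K)(x,y)f(y)`
the level-`j` slice carries the extra factor `(L^jη)²` (B4 (2.39)), the sum over scales converges on the diagonal too, and the η-rate holds for
ALL sources — proved here by the induction of parts O on the operator peel:
* §1 `sum_fine_blockOf` (`Σ_{y ∈ Tor(fine N U)} φ(B y) = N^{d′}·Σ_b φ(b)`), `rowSum_exp_blocks_le` (`Σ_y e^{−κ|B x − B y|_U} ≤ N^{d′}·K_{d′}(κ)`);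
* §2 **`fullPropOp_peel_pair`** — the operator peel of the pair (`Equiv.sum_comp` along `flatten ≫ torCongr`, part O-b `underPtN_flatten` ∕
  `fullProp_peel_fine'`, part O-a `fullProp_peel'`): the unit factor `L^{d+1}∕L²` of (2.20) against the measure factor `L^{−(d+1)}` IS `L^{−2}` per level;
* §3 `sliceOp_pair_le` — the slice pair against a bounded source: `≤ C_r·K(κ)·(L^{−γ∕2})^K·F` (part M `ksSlice_rate_unif` + `blockOf_underPtN` + §1);
* §4 ★ **`fullPropOp_rate_unif`** — `|Σ_{y′}(L^nL^K)^{−(d+1)}[G^{η′}_{K+n}(x′, y′) − G^η_K(x, y)]f′(y′)| ≤ C·(L^{−γ∕2})^K·F` for EVERY `K, n ≥ 1`, cube `2L^e`,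
  `0 < m² ≤ m₀²`, bounded source `f′` and fine point `x′` (`x, y` under `x′, y′`); induction on `K` (per-level `L^{−2}·2 ≤ L^{−1} ≤ L^{−γ∕2}`), base =
  [Ba 4] (1.10) in sup-norm form (`King1986.Torus.fineOp_inv_mulVec_le_unif`) for the fine run + `constrainedProp_decay_blocks_unif` with the row sum
  for the coarse run read through the pairing.  The printed decay from the support and the printed operator shape are parts P′ ∕ P″.
HONEST SCOPE.  (i) `A = 0`, periodic b.c., odd `L ≥ 3`, `0 < m² ≤ m₀²`, cubes `2L^e`; (ii) the coarse source is the fine one read through King's pairing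
with the fine measure `(L^nL^K)^{−(d+1)}`; (iii) `K, n ≥ 1`; (iv) not Bałaban's `G_k(U)` (curved case: the (3.42) entries of `G_k(U)` uniformly over the
live window `Reg335`; print gives analyticity in `U` and η-uniformity, never an η-difference); not a discharge.
Locators: [King1986] C. King, CMP **102** (1986) 649–677: (2.13)–(2.17) p. 653, (2.20) p. 654, Theorem 3.3 (3.7) p. 658, Prop. 3.8 (3.71) p. 664,
(4.42)–(4.43) p. 675; [Ba 4] = [Balaban1983RegularityDecay] Theorem (1.10) p. 573, (2.39) p. 582.
-/

noncomputable section

namespace Summit.QuantumFields.YangMills.BalabanUVNodes.N15KingModelRung.Curved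

open Real Finset Matrix
open Literature.MathematicalPhysics.QuantumFieldTheory.Balaban1983to89 (Params)
open Literature.MathematicalPhysics.QuantumFieldTheory.Balaban1983to89.B4Sect5Proof (latticeConst latticeConst_nonneg)
open Literature.MathematicalPhysics.QuantumFieldTheory.Balaban1983to89.B5Prop11Plancherel (Tor fine)
open Literature.MathematicalPhysics.QuantumFieldTheory.King1986 (aK aK_pos)
open Literature.MathematicalPhysics.QuantumFieldTheory.King1986.Torus (constrainedProp fineOp flatten blockOf tdistT torCongr site
  blockEquiv blockEquiv_apply blockOf_site tdistT_nonneg tdistT_sumBound constrainedProp_decay_blocks_unif fineOp_inv_mulVec_le_unif)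

variable {d : ℕ} (L : ℕ) [NeZero L]

/-! ## §1 Block-fibre sums on the fine torus -/

omit [NeZero L] in
/-- **Summing a block function over the fine torus**: `Σ_{y ∈ Tor(fine N U)} φ(B y) = N^{d′}·Σ_b φ(b)` (every block has `N^{d′}` fine points:
`TorusBlockForm.blockEquiv`). [folklore] -/
theorem sum_fine_blockOf {d' : ℕ} (N : ℕ) [NeZero N] (U : Fin d' → ℕ) [∀ μ, NeZero (U μ)] (φ : Tor U → ℝ) :
    ∑ y : Tor (fine N U), φ (blockOf N U y) = ((N : ℝ) ^ d') * ∑ b, φ b := by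
  rw [← (blockEquiv N U).sum_comp (fun y => φ (blockOf N U y)), Fintype.sum_prod_type]
  simp only [blockEquiv_apply, blockOf_site, Finset.sum_const, Finset.card_univ, Fintype.card_pi, Fintype.card_fin,
    Finset.prod_const, nsmul_eq_mul]
  rw [Finset.mul_sum]
  push_cast
  rfl

omit [NeZero L] in
/-- **Row sums of a block-distance weight over the fine torus**: `Σ_y e^{−κ|B x₀ − B y|_U} ≤ N^{d′}·K_{d′}(κ)` (`κ > 0`; §1 + `tdistT_sumBound`).
[cite: Balaban1983RegularityDecay, (5.9) p.593 (lattice sums)] -/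
theorem rowSum_exp_blocks_le {d' : ℕ} (N : ℕ) [NeZero N] (U : Fin d' → ℕ) [∀ μ, NeZero (U μ)] {κ : ℝ} (hκ : 0 < κ)
    (b₀ : Tor U) :
    ∑ y : Tor (fine N U), Real.exp (-(κ * tdistT U b₀ (blockOf N U y))) ≤ ((N : ℝ) ^ d') * latticeConst d' κ := by
  rw [sum_fine_blockOf N U (fun b => Real.exp (-(κ * tdistT U b₀ b)))]
  exact mul_le_mul_of_nonneg_left (tdistT_sumBound U κ hκ b₀) (by positivity)

/-! ## §2 The operator peel of the pair -/

/-- **THE OPERATOR PEEL OF THE PAIR**: for the slice index `i = (e, K = i.j, n = i.n, …)`, `a > 0`, `m² > 0`, `L ≥ 2`, the spelling bridge `h`, a source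
`f̂′` on the `(K+1+n)`-level fine lattice over the cube `M_e` and a fine point `x′` of the nested torus:
`Σ_{ŷ′}(L^nL^{K+1})^{−(d+1)}[G(K+1+n)(e(flatten x′), ŷ′) − G(K+1)(û(e(flatten x′)), û ŷ′)]·f̂′(ŷ′)
 = L^{−2}·Σ_{y′}(L^nL^K)^{−(d+1)}{[G(K+n)^{sub}(x′, y′) − G(K)^{sub}(u x′, u y′)] + [ksSlice′(x′, y′) − ksSlice(u x′, u y′)]}·f̂′(e(flatten y′))`
(masses: `m²` upstairs, `m²∕L²` downstairs; `u`, `û` King's pairings at levels `K`, `K+1`). [cite: King1986, (2.17) p.653, (2.20) p.654, (4.42) p.675; Balaban1983RegularityDecay, (2.39) p.582] -/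
theorem fullPropOp_peel_pair (hL : 2 ≤ L) {a msq : ℝ} (ha : 0 < a) (hm : 0 < msq) (i : KSliceIdx d)
    (h : ∀ ν, fine (L ^ i.n * L ^ i.j * L) (ksM L i) ν = fine (L ^ i.n * L ^ (i.j + 1)) (ksM L i) ν)
    (f' : Tor (fine (L ^ i.n * L ^ (i.j + 1)) (ksM L i)) → ℝ) (x' : Tor (fine (L ^ i.n * L ^ i.j) (ksU L i))) :
    ∑ y'' : Tor (fine (L ^ i.n * L ^ (i.j + 1)) (ksM L i)),
        ((((L ^ i.n * L ^ (i.j + 1) : ℕ) : ℝ) ^ (d + 1))⁻¹ *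
          (constrainedProp (L ^ i.n * L ^ (i.j + 1)) (ksM L i) (aK a L (i.j + 1 + i.n))
              (((L ^ i.n * L ^ (i.j + 1) : ℕ) : ℝ) ^ 2) msq
              (torCongr h (flatten (L ^ i.n * L ^ i.j) L (ksM L i) x')) y''
            - constrainedProp (L ^ i.j * L) (ksM L i) (aK a L (i.j + 1)) (((L ^ i.j * L : ℕ) : ℝ) ^ 2) msq
              (underPtN L (i.j + 1) i.n (ksM L i) (torCongr h (flatten (L ^ i.n * L ^ i.j) L (ksM L i) x')))
              (underPtN L (i.j + 1) i.n (ksM L i) y''))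
          * f' y'')
      = ((L : ℝ) ^ 2)⁻¹ *
        ∑ y' : Tor (fine (L ^ i.n * L ^ i.j) (ksU L i)),
          ((((L ^ i.n * L ^ i.j : ℕ) : ℝ) ^ (d + 1))⁻¹ *
            ((constrainedProp (L ^ i.n * L ^ i.j) (ksU L i) (aK a L (i.j + i.n)) (((L ^ i.n * L ^ i.j : ℕ) : ℝ) ^ 2)
                  (msq / (L : ℝ) ^ 2) x' y'
                - constrainedProp (L ^ i.j) (ksU L i) (aK a L i.j) (((L ^ i.j : ℕ) : ℝ) ^ 2) (msq / (L : ℝ) ^ 2)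
                  (underPtN L i.j i.n (ksU L i) x') (underPtN L i.j i.n (ksU L i) y'))
              + (ksSlice' L a (msq / (L : ℝ) ^ 2) i x' y'
                - ksSlice L a (msq / (L : ℝ) ^ 2) i (underPtN L i.j i.n (ksU L i) x') (underPtN L i.j i.n (ksU L i) y')))
            * f' (torCongr h (flatten (L ^ i.n * L ^ i.j) L (ksM L i) y'))) := by
  have hL0 : (0 : ℝ) < L := by exact_mod_cast (show 0 < L by omega)
  have hLne : (L : ℝ) ≠ 0 := hL0.ne'
  -- re-index the fine sum along `flatten ≫ torCongr`
  rw [← ((flatten (L ^ i.n * L ^ i.j) L (ksM L i)).trans (torCongr h)).sum_comp]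
  simp only [Equiv.trans_apply]
  rw [Finset.mul_sum]
  refine Finset.sum_congr rfl fun y' _ => ?_
  rw [underPtN_flatten L i.j i.n (ksM L i) h x', underPtN_flatten L i.j i.n (ksM L i) h y',
    fullProp_peel_fine' L hL ha hm i x' y' h, fullProp_peel' L hL ha hm i _ _]
  have hcast : (((L ^ i.n * L ^ (i.j + 1) : ℕ) : ℝ)) = ((L ^ i.n * L ^ i.j : ℕ) : ℝ) * L := by push_cast; ring
  rw [hcast]
  have hNK : (((L ^ i.n * L ^ i.j : ℕ) : ℝ)) ≠ 0 := by positivity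
  field_simp
  ring

/-! ## §3 The slice pair against a bounded source -/

/-- **The slice pair against a bounded source, in the fine measure**: with the `(C_r, κ)` of part M `ksSlice_rate_unif` (mass `m²` in its window),
for every index, every `f` with `|f| ≤ F` and every fine `x′`:
`|Σ_{y′}(L^nL^K)^{−(d+1)}[ksSlice′(x′, y′) − ksSlice(u x′, u y′)]f(y′)| ≤ C_r·K(κ)·(L^{−γ∕2})^K·F` — the `(L^nL^K)^{d+1}` fine points of a unit block
cancel the measure factor (§1). [cite: King1986, (4.42)–(4.43) p.675; Balaban1983RegularityDecay, (2.39) p.582] -/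
theorem sliceOp_pair_le {a m2 Cr κ γ : ℝ} (hκ : 0 < κ) (hCr : 0 ≤ Cr) (i : KSliceIdx d)
    (Hr : ∀ x' y' : Tor (fine (L ^ i.n * L ^ i.j) (ksU L i)),
      |ksSlice' L a m2 i x' y' - ksSlice L a m2 i (underPtN L i.j i.n (ksU L i) x') (underPtN L i.j i.n (ksU L i) y')|
        ≤ Cr * (((L : ℝ) ^ (-(γ / 2))) ^ i.j)
          * Real.exp (-(κ * tdistT (ksU L i) (blockOf (L ^ i.j) (ksU L i) (underPtN L i.j i.n (ksU L i) x'))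
              (blockOf (L ^ i.j) (ksU L i) (underPtN L i.j i.n (ksU L i) y')))))
    (f : Tor (fine (L ^ i.n * L ^ i.j) (ksU L i)) → ℝ) {F : ℝ} (hF : ∀ y', |f y'| ≤ F)
    (x' : Tor (fine (L ^ i.n * L ^ i.j) (ksU L i))) :
    |∑ y', (((L ^ i.n * L ^ i.j : ℕ) : ℝ) ^ (d + 1))⁻¹ *
        (ksSlice' L a m2 i x' y' - ksSlice L a m2 i (underPtN L i.j i.n (ksU L i) x') (underPtN L i.j i.n (ksU L i) y')) * f y'|
      ≤ Cr * latticeConst (d + 1) κ * (((L : ℝ) ^ (-(γ / 2))) ^ i.j) * F := by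
  have hLne : (L : ℝ) ≠ 0 := by exact_mod_cast (NeZero.ne L)
  have hF0 : 0 ≤ F := (abs_nonneg _).trans (hF x')
  set w : ℝ := ((((L ^ i.n * L ^ i.j : ℕ) : ℝ)) ^ (d + 1))⁻¹ with hw
  have hw0 : 0 ≤ w := by positivity
  set s : ℝ := ((L : ℝ) ^ (-(γ / 2))) ^ i.j with hs
  have hs0 : 0 ≤ s := pow_nonneg (Real.rpow_nonneg (Nat.cast_nonneg _) _) _
  set b₀ := blockOf (L ^ i.n * L ^ i.j) (ksU L i) x' with hb₀
  -- termwise bound with the block distance of the fine points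
  have hterm : ∀ y', |w * (ksSlice' L a m2 i x' y'
        - ksSlice L a m2 i (underPtN L i.j i.n (ksU L i) x') (underPtN L i.j i.n (ksU L i) y')) * f y'|
      ≤ w * (Cr * s * F) * Real.exp (-(κ * tdistT (ksU L i) b₀ (blockOf (L ^ i.n * L ^ i.j) (ksU L i) y'))) := by
    intro y'
    have h1 := Hr x' y'
    rw [blockOf_underPtN, blockOf_underPtN] at h1
    rw [abs_mul, abs_mul, abs_of_nonneg hw0]
    have h2 := hF y'
    calc w * |ksSlice' L a m2 i x' y' - ksSlice L a m2 i (underPtN L i.j i.n (ksU L i) x') (underPtN L i.j i.n (ksU L i) y')| * |f y'|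
        ≤ w * (Cr * s * Real.exp (-(κ * tdistT (ksU L i) b₀ (blockOf (L ^ i.n * L ^ i.j) (ksU L i) y')))) * F :=
          mul_le_mul (mul_le_mul_of_nonneg_left h1 hw0) h2 (abs_nonneg _) (by positivity)
      _ = w * (Cr * s * F) * Real.exp (-(κ * tdistT (ksU L i) b₀ (blockOf (L ^ i.n * L ^ i.j) (ksU L i) y'))) := by ring
  have hrow := rowSum_exp_blocks_le (L ^ i.n * L ^ i.j) (ksU L i) hκ b₀
  calc |∑ y', w * (ksSlice' L a m2 i x' y'
          - ksSlice L a m2 i (underPtN L i.j i.n (ksU L i) x') (underPtN L i.j i.n (ksU L i) y')) * f y'|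
      ≤ ∑ y', |w * (ksSlice' L a m2 i x' y'
          - ksSlice L a m2 i (underPtN L i.j i.n (ksU L i) x') (underPtN L i.j i.n (ksU L i) y')) * f y'| :=
        Finset.abs_sum_le_sum_abs _ _
    _ ≤ ∑ y', w * (Cr * s * F) * Real.exp (-(κ * tdistT (ksU L i) b₀ (blockOf (L ^ i.n * L ^ i.j) (ksU L i) y'))) :=
        Finset.sum_le_sum fun y' _ => hterm y'
    _ = w * (Cr * s * F) * ∑ y', Real.exp (-(κ * tdistT (ksU L i) b₀ (blockOf (L ^ i.n * L ^ i.j) (ksU L i) y'))) := by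
        rw [Finset.mul_sum]
    _ ≤ w * (Cr * s * F) * ((((L ^ i.n * L ^ i.j : ℕ) : ℝ)) ^ (d + 1) * latticeConst (d + 1) κ) :=
        mul_le_mul_of_nonneg_left (by exact_mod_cast hrow) (by positivity)
    _ = Cr * latticeConst (d + 1) κ * s * F := by
        have hN : ((((L ^ i.n * L ^ i.j : ℕ) : ℝ)) ^ (d + 1)) ≠ 0 :=
          pow_ne_zero _ (by exact_mod_cast NeZero.ne (L ^ i.n * L ^ i.j))
        rw [hw]; field_simp

/-! ## §4 The operator-form η-rate, all sources -/

/-- **THE TWO-SPACING η-RATE OF KING'S FULL `A = 0` FLUCTUATION PROPAGATOR AS AN OPERATOR, ALL SOURCES** (Theorem 3.3 (3.7) ∕ [Ba 4] (1.10)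
currency with the (3.71) rate): for odd `L ≥ 3`, `a > 0`, a mass cap `m₀² ≥ 0` and `0 ≤ γ ≤ 1` there is `C > 0` (function of `d, L, a, m₀², γ`) such that
for EVERY `K ≥ 1`, `n ≥ 1`, cube `M_μ = 2L^e`, mass `0 < m² ≤ m₀²`, source `f′` with `|f′| ≤ F` on the fine `(K+n)`-level lattice and fine point `x′`:
`|Σ_{y′}(L^nL^K)^{−(d+1)}·[G^{η′}_{K+n}(x′, y′) − G^η_K(x, y)]·f′(y′)| ≤ C·(L^{−γ∕2})^K·F` (`x, y` under `x′, y′`; `(L^nL^K)^{−(d+1)} = η′^{d+1}` the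
fine measure, so the first term IS `(A₀′⁻¹f′)(x′)`).  No off-diagonal restriction: in operator form the level-`j` slice weighs `(L^jη)²`.  Induction on
`K` (module docstring). [cite: King1986, (2.13)–(2.17) p.653, (2.20) p.654, Theorem 3.3 (3.7) p.658, Prop. 3.8 (3.71) p.664, (4.42)–(4.43) p.675; Balaban1983RegularityDecay, Theorem (1.10) p.573, (2.39) p.582] -/
theorem fullPropOp_rate_unif (hLodd : Odd L) (hL : 2 ≤ L) {a : ℝ} (ha : 0 < a) {m0sq : ℝ} (hm0 : 0 ≤ m0sq) {γ : ℝ}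
    (hγ0 : 0 ≤ γ) (hγ1 : γ ≤ 1) :
    ∃ C : ℝ, 0 < C ∧ ∀ (K : ℕ), 1 ≤ K → ∀ (n : ℕ), 1 ≤ n →
      ∀ (e : ℕ) (M : Fin (d + 1) → ℕ) [∀ μ, NeZero (M μ)], (∀ μ, M μ = 2 * L ^ e) →
      ∀ (msq : ℝ), 0 < msq → msq ≤ m0sq →
      ∀ (f' : Tor (fine (L ^ n * L ^ K) M) → ℝ) (F : ℝ), (∀ y', |f' y'| ≤ F) → ∀ x' : Tor (fine (L ^ n * L ^ K) M),
        |∑ y', ((((L ^ n * L ^ K : ℕ) : ℝ) ^ (d + 1))⁻¹ *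
            (constrainedProp (L ^ n * L ^ K) M (aK a L (K + n)) (((L ^ n * L ^ K : ℕ) : ℝ) ^ 2) msq x' y'
              - constrainedProp (L ^ K) M (aK a L K) (((L ^ K : ℕ) : ℝ) ^ 2) msq
                (underPtN L K n M x') (underPtN L K n M y'))
            * f' y')|
          ≤ C * (((L : ℝ) ^ (-(γ / 2))) ^ K) * F := by
  have hL1 : 1 < L := by omega
  have hL1' : (1 : ℝ) ≤ L := by exact_mod_cast hL1.le
  have hL0 : (0 : ℝ) < L := by positivity
  have hLne : (L : ℝ) ≠ 0 := hL0.ne'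
  -- the rate `θ = L^{−γ∕2} ≥ L⁻¹`
  set θ : ℝ := (L : ℝ) ^ (-(γ / 2)) with hθdef
  have hθ0 : 0 < θ := Real.rpow_pos_of_pos hL0 _
  have hθL : (L : ℝ)⁻¹ ≤ θ := by
    rw [hθdef, ← Real.rpow_neg_one]
    exact Real.rpow_le_rpow_of_exponent_le hL1' (by linarith)
  -- the base constants: (1.10) sup-norm form (fine run) and the one-level kernel decay (coarse run); the slice-pair constants (part M)
  obtain ⟨c₀, hc₀, H₀⟩ := fineOp_inv_mulVec_le_unif (d + 1) L (by omega) ⟨hLodd, hL1⟩ ha hm0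
  obtain ⟨δb, cb, hδb, hcb, Hb⟩ := constrainedProp_decay_blocks_unif (d + 1) L (by omega) ⟨hLodd, hL1⟩ ha hm0
  obtain ⟨Cr, κ, hCr, hκ, Hr⟩ := ksSlice_rate_unif (d := d) L hLodd hL ha hm0 hγ0 hγ1
  have hKb := latticeConst_nonneg (d + 1) hδb.le
  have hKr := latticeConst_nonneg (d + 1) hκ.le
  set B₁ : ℝ := c₀ + (L : ℝ) ^ (d + 1) * cb * latticeConst (d + 1) δb with hB₁
  have hB₁0 : 0 < B₁ := by positivity
  set C : ℝ := max ((L : ℝ) * B₁) (Cr * latticeConst (d + 1) κ + 1) with hCdef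
  have hC : 0 < C := lt_max_of_lt_left (mul_pos hL0 hB₁0)
  have hCB : (L : ℝ) * B₁ ≤ C := le_max_left _ _
  have hCr' : Cr * latticeConst (d + 1) κ ≤ C := by linarith [le_max_right ((L : ℝ) * B₁) (Cr * latticeConst (d + 1) κ + 1)]
  refine ⟨C, hC, ?_⟩
  intro K hK
  induction K, hK using Nat.le_induction with
  | base =>
    intro n hn e M _ hM msq hmsq hcap f' F hF x'
    have hF0 : 0 ≤ F := (abs_nonneg _).trans (hF x')
    set w : ℝ := ((((L ^ n * L ^ 1 : ℕ) : ℝ)) ^ (d + 1))⁻¹ with hw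
    have hw0 : 0 ≤ w := by positivity
    set P' : Params := ⟨d + 1, L, e, 1 + n, by omega, ⟨hLodd, hL1⟩⟩ with hP'
    have hMK' : ∀ μ, M μ = P'.sitesPerDir P'.K := fun μ => by rw [hM μ]; simp [hP', Params.sitesPerDir]
    set P : Params := ⟨d + 1, L, e, 1, by omega, ⟨hLodd, hL1⟩⟩ with hP
    have hMK : ∀ μ, M μ = P.sitesPerDir P.K := fun μ => by rw [hM μ]; simp [hP, Params.sitesPerDir]
    -- split the pair termwise: the fine term IS `(A₀′⁻¹ f′)(x′)`
    have hsplit : ∀ y', w * (constrainedProp (L ^ n * L ^ 1) M (aK a L (1 + n)) (((L ^ n * L ^ 1 : ℕ) : ℝ) ^ 2) msq x' y'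
          - constrainedProp (L ^ 1) M (aK a L 1) (((L ^ 1 : ℕ) : ℝ) ^ 2) msq (underPtN L 1 n M x') (underPtN L 1 n M y')) * f' y'
        = (fineOp (L ^ n * L ^ 1) M (aK a L (1 + n)) (((L ^ n * L ^ 1 : ℕ) : ℝ) ^ 2) msq)⁻¹ x' y' * f' y'
          - w * constrainedProp (L ^ 1) M (aK a L 1) (((L ^ 1 : ℕ) : ℝ) ^ 2) msq (underPtN L 1 n M x') (underPtN L 1 n M y')
            * f' y' := by
      intro y'
      have hN0 : ((((L ^ n * L ^ 1 : ℕ) : ℝ)) ^ (d + 1)) ≠ 0 :=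
        pow_ne_zero _ (by exact_mod_cast NeZero.ne (L ^ n * L ^ 1))
      have hG : constrainedProp (L ^ n * L ^ 1) M (aK a L (1 + n)) (((L ^ n * L ^ 1 : ℕ) : ℝ) ^ 2) msq x' y'
          = (((L ^ n * L ^ 1 : ℕ) : ℝ)) ^ (d + 1)
            * (fineOp (L ^ n * L ^ 1) M (aK a L (1 + n)) (((L ^ n * L ^ 1 : ℕ) : ℝ) ^ 2) msq)⁻¹ x' y' := by
        rw [constrainedProp, Matrix.smul_apply, smul_eq_mul]
      rw [hG, hw]
      field_simp
    have hsum_eq : ∑ y', w * (constrainedProp (L ^ n * L ^ 1) M (aK a L (1 + n)) (((L ^ n * L ^ 1 : ℕ) : ℝ) ^ 2) msq x' y'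
          - constrainedProp (L ^ 1) M (aK a L 1) (((L ^ 1 : ℕ) : ℝ) ^ 2) msq (underPtN L 1 n M x') (underPtN L 1 n M y')) * f' y'
        = ∑ y', (fineOp (L ^ n * L ^ 1) M (aK a L (1 + n)) (((L ^ n * L ^ 1 : ℕ) : ℝ) ^ 2) msq)⁻¹ x' y' * f' y'
          - ∑ y', w * constrainedProp (L ^ 1) M (aK a L 1) (((L ^ 1 : ℕ) : ℝ) ^ 2) msq (underPtN L 1 n M x')
              (underPtN L 1 n M y') * f' y' := by
      rw [← Finset.sum_sub_distrib]
      exact Finset.sum_congr rfl fun y' _ => hsplit y'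
    have hfine : |∑ y', (fineOp (L ^ n * L ^ 1) M (aK a L (1 + n)) (((L ^ n * L ^ 1 : ℕ) : ℝ) ^ 2) msq)⁻¹ x' y' * f' y'| ≤ c₀ * F := by
      have h := H₀ P' rfl rfl (by show 1 ≤ 1 + n; omega) msq hmsq.le hcap M hMK' (L ^ n * L ^ 1)
        (by show L ^ n * L ^ 1 = L ^ (1 + n); rw [pow_add, mul_comm]) f' F hF x'
      exact h
    -- the coarse run read through the pairing: one-level kernel decay + row sum
    have hcoarse : |∑ y', w * constrainedProp (L ^ 1) M (aK a L 1) (((L ^ 1 : ℕ) : ℝ) ^ 2) msq (underPtN L 1 n M x')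
          (underPtN L 1 n M y') * f' y'| ≤ (L : ℝ) ^ (d + 1) * cb * latticeConst (d + 1) δb * F := by
      have hb : ∀ y', |w * constrainedProp (L ^ 1) M (aK a L 1) (((L ^ 1 : ℕ) : ℝ) ^ 2) msq (underPtN L 1 n M x')
            (underPtN L 1 n M y') * f' y'|
          ≤ w * ((L : ℝ) ^ (d + 1) * cb * F)
            * Real.exp (-(δb * tdistT M (blockOf (L ^ n * L ^ 1) M x') (blockOf (L ^ n * L ^ 1) M y'))) := by
        intro y'
        have h1 := Hb P rfl rfl le_rfl msq hmsq.le hcap M hMK (L ^ 1) rfl (underPtN L 1 n M x') (underPtN L 1 n M y')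
        have hcast : (((L ^ 1 : ℕ) : ℝ)) ^ P.d * cb = (L : ℝ) ^ (d + 1) * cb := by simp [hP]
        rw [hcast, blockOf_underPtN, blockOf_underPtN] at h1
        rw [abs_mul, abs_mul, abs_of_nonneg hw0]
        calc w * |constrainedProp (L ^ 1) M (aK a L 1) (((L ^ 1 : ℕ) : ℝ) ^ 2) msq (underPtN L 1 n M x') (underPtN L 1 n M y')| * |f' y'|
            ≤ w * ((L : ℝ) ^ (d + 1) * cb
                * Real.exp (-(δb * tdistT M (blockOf (L ^ n * L ^ 1) M x') (blockOf (L ^ n * L ^ 1) M y')))) * F :=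
              mul_le_mul (mul_le_mul_of_nonneg_left h1 hw0) (hF y') (abs_nonneg _) (by positivity)
          _ = _ := by ring
      have hrow := rowSum_exp_blocks_le (L ^ n * L ^ 1) M hδb (blockOf (L ^ n * L ^ 1) M x')
      calc |∑ y', w * constrainedProp (L ^ 1) M (aK a L 1) (((L ^ 1 : ℕ) : ℝ) ^ 2) msq (underPtN L 1 n M x')
              (underPtN L 1 n M y') * f' y'|
          ≤ ∑ y', |w * constrainedProp (L ^ 1) M (aK a L 1) (((L ^ 1 : ℕ) : ℝ) ^ 2) msq (underPtN L 1 n M x')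
              (underPtN L 1 n M y') * f' y'| := Finset.abs_sum_le_sum_abs _ _
        _ ≤ ∑ y', w * ((L : ℝ) ^ (d + 1) * cb * F)
              * Real.exp (-(δb * tdistT M (blockOf (L ^ n * L ^ 1) M x') (blockOf (L ^ n * L ^ 1) M y'))) :=
            Finset.sum_le_sum fun y' _ => hb y'
        _ = w * ((L : ℝ) ^ (d + 1) * cb * F)
              * ∑ y', Real.exp (-(δb * tdistT M (blockOf (L ^ n * L ^ 1) M x') (blockOf (L ^ n * L ^ 1) M y'))) := by
            rw [Finset.mul_sum]
        _ ≤ w * ((L : ℝ) ^ (d + 1) * cb * F) * ((((L ^ n * L ^ 1 : ℕ) : ℝ)) ^ (d + 1) * latticeConst (d + 1) δb) :=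
            mul_le_mul_of_nonneg_left (by exact_mod_cast hrow) (by positivity)
        _ = (L : ℝ) ^ (d + 1) * cb * latticeConst (d + 1) δb * F := by
            have hN0 : ((((L ^ n * L ^ 1 : ℕ) : ℝ)) ^ (d + 1)) ≠ 0 :=
              pow_ne_zero _ (by exact_mod_cast NeZero.ne (L ^ n * L ^ 1))
            rw [hw]; field_simp
    have hθ1 : B₁ ≤ C * θ ^ 1 := by
      rw [pow_one]
      calc B₁ = (L : ℝ) * B₁ * (L : ℝ)⁻¹ := by field_simp
        _ ≤ C * θ := mul_le_mul hCB hθL (inv_pos.mpr hL0).le hC.le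
    calc |∑ y', w * (constrainedProp (L ^ n * L ^ 1) M (aK a L (1 + n)) (((L ^ n * L ^ 1 : ℕ) : ℝ) ^ 2) msq x' y'
            - constrainedProp (L ^ 1) M (aK a L 1) (((L ^ 1 : ℕ) : ℝ) ^ 2) msq (underPtN L 1 n M x') (underPtN L 1 n M y'))
            * f' y'|
        = |∑ y', (fineOp (L ^ n * L ^ 1) M (aK a L (1 + n)) (((L ^ n * L ^ 1 : ℕ) : ℝ) ^ 2) msq)⁻¹ x' y' * f' y'
            - ∑ y', w * constrainedProp (L ^ 1) M (aK a L 1) (((L ^ 1 : ℕ) : ℝ) ^ 2) msq (underPtN L 1 n M x')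
              (underPtN L 1 n M y') * f' y'| := by rw [hsum_eq]
      _ ≤ |∑ y', (fineOp (L ^ n * L ^ 1) M (aK a L (1 + n)) (((L ^ n * L ^ 1 : ℕ) : ℝ) ^ 2) msq)⁻¹ x' y' * f' y'|
            + |∑ y', w * constrainedProp (L ^ 1) M (aK a L 1) (((L ^ 1 : ℕ) : ℝ) ^ 2) msq (underPtN L 1 n M x')
              (underPtN L 1 n M y') * f' y'| := abs_sub _ _
      _ ≤ c₀ * F + (L : ℝ) ^ (d + 1) * cb * latticeConst (d + 1) δb * F := add_le_add hfine hcoarse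
      _ = B₁ * F := by rw [hB₁]; ring
      _ ≤ C * θ ^ 1 * F := mul_le_mul_of_nonneg_right hθ1 hF0
  | succ K hK IH =>
    intro n hn e M _ hM msq hmsq hcap f'' F hF x''
    have hF0 : 0 ≤ F := (abs_nonneg _).trans (hF x'')
    obtain rfl : M = fun _ => 2 * L ^ e := funext hM
    set i : KSliceIdx d := ⟨e, K, hK, n, hn, 0, Nat.zero_le e, 1, le_rfl⟩ with hidef
    have h : ∀ ν, fine (L ^ n * L ^ K * L) (ksM L i) ν = fine (L ^ n * L ^ (K + 1)) (ksM L i) ν :=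
      fine_assoc L K n (ksM L i)
    obtain ⟨x', rfl⟩ := ((flatten (L ^ n * L ^ K) L (ksM L i)).trans (torCongr h)).surjective x''
    simp only [Equiv.trans_apply]
    -- the source one level down is `y′ ↦ f̂′(e(flatten y′))`; the mass one level down is `m²∕L²`
    have hgF : ∀ y' : Tor (fine (L ^ n * L ^ K) (ksU L i)),
        |(fun y' => f'' (torCongr h (flatten (L ^ n * L ^ K) L (ksM L i) y'))) y'| ≤ F := fun y' => hF _
    have hL2 : (0 : ℝ) < (L : ℝ) ^ 2 := by positivity
    have hm2 : 0 < msq / (L : ℝ) ^ 2 := div_pos hmsq hL2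
    have hm2cap : msq / (L : ℝ) ^ 2 ≤ m0sq := by
      have h1 : (1 : ℝ) ≤ (L : ℝ) ^ 2 := one_le_pow₀ hL1'
      exact (div_le_self hmsq.le h1).trans hcap
    have hM' : ∀ μ, ksU L i μ = 2 * L ^ (e + 1) := fun μ => by
      show L * (2 * L ^ e) = 2 * L ^ (e + 1)
      ring
    -- the operator peel
    have hpeel := fullPropOp_peel_pair L hL ha hmsq i h f'' x'
    set w : ℝ := ((((L ^ n * L ^ K : ℕ) : ℝ)) ^ (d + 1))⁻¹ with hw
    have hIH : |∑ y', w * (constrainedProp (L ^ n * L ^ K) (ksU L i) (aK a L (K + n)) (((L ^ n * L ^ K : ℕ) : ℝ) ^ 2)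
              (msq / (L : ℝ) ^ 2) x' y'
            - constrainedProp (L ^ K) (ksU L i) (aK a L K) (((L ^ K : ℕ) : ℝ) ^ 2) (msq / (L : ℝ) ^ 2)
              (underPtN L K n (ksU L i) x') (underPtN L K n (ksU L i) y'))
            * f'' (torCongr h (flatten (L ^ n * L ^ K) L (ksM L i) y'))| ≤ C * θ ^ K * F :=
      IH n hn (e + 1) (ksU L i) hM' (msq / (L : ℝ) ^ 2) hm2 hm2cap _ F hgF x'
    have hS : |∑ y', w * (ksSlice' L a (msq / (L : ℝ) ^ 2) i x' y'
            - ksSlice L a (msq / (L : ℝ) ^ 2) i (underPtN L K n (ksU L i) x') (underPtN L K n (ksU L i) y'))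
            * f'' (torCongr h (flatten (L ^ n * L ^ K) L (ksM L i) y'))|
          ≤ Cr * latticeConst (d + 1) κ * θ ^ K * F :=
      sliceOp_pair_le L hκ hCr.le i (Hr (msq / (L : ℝ) ^ 2) hm2 hm2cap i) _ hgF x'
    -- the two sums together
    have hsum : ∑ y', w * ((constrainedProp (L ^ n * L ^ K) (ksU L i) (aK a L (K + n)) (((L ^ n * L ^ K : ℕ) : ℝ) ^ 2)
              (msq / (L : ℝ) ^ 2) x' y'
            - constrainedProp (L ^ K) (ksU L i) (aK a L K) (((L ^ K : ℕ) : ℝ) ^ 2) (msq / (L : ℝ) ^ 2)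
              (underPtN L K n (ksU L i) x') (underPtN L K n (ksU L i) y'))
            + (ksSlice' L a (msq / (L : ℝ) ^ 2) i x' y'
              - ksSlice L a (msq / (L : ℝ) ^ 2) i (underPtN L K n (ksU L i) x') (underPtN L K n (ksU L i) y')))
            * f'' (torCongr h (flatten (L ^ n * L ^ K) L (ksM L i) y'))
        = ∑ y', w * (constrainedProp (L ^ n * L ^ K) (ksU L i) (aK a L (K + n)) (((L ^ n * L ^ K : ℕ) : ℝ) ^ 2)
              (msq / (L : ℝ) ^ 2) x' y'
            - constrainedProp (L ^ K) (ksU L i) (aK a L K) (((L ^ K : ℕ) : ℝ) ^ 2) (msq / (L : ℝ) ^ 2)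
              (underPtN L K n (ksU L i) x') (underPtN L K n (ksU L i) y'))
            * f'' (torCongr h (flatten (L ^ n * L ^ K) L (ksM L i) y'))
          + ∑ y', w * (ksSlice' L a (msq / (L : ℝ) ^ 2) i x' y'
            - ksSlice L a (msq / (L : ℝ) ^ 2) i (underPtN L K n (ksU L i) x') (underPtN L K n (ksU L i) y'))
            * f'' (torCongr h (flatten (L ^ n * L ^ K) L (ksM L i) y')) := by
      rw [← Finset.sum_add_distrib]
      exact Finset.sum_congr rfl fun y' _ => by ring
    -- the gain: `L^{−2}·(C + C_rK)·θ^K ≤ C·θ^{K+1}`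
    have hgain : ((L : ℝ) ^ 2)⁻¹ * (C * θ ^ K * F + Cr * latticeConst (d + 1) κ * θ ^ K * F) ≤ C * θ ^ (K + 1) * F := by
      have h2L : (2 : ℝ) ≤ L := by exact_mod_cast hL
      have hstep1 : C * θ ^ K * F + Cr * latticeConst (d + 1) κ * θ ^ K * F ≤ 2 * C * (θ ^ K * F) := by
        have h1 : C * θ ^ K * F + Cr * latticeConst (d + 1) κ * θ ^ K * F = (C + Cr * latticeConst (d + 1) κ) * (θ ^ K * F) := by
          ring
        rw [h1]
        exact mul_le_mul_of_nonneg_right (by linarith) (mul_nonneg (pow_nonneg hθ0.le K) hF0)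
      have hstep2 : ((L : ℝ) ^ 2)⁻¹ * (2 * C) ≤ C * θ := by
        rw [show ((L : ℝ) ^ 2)⁻¹ * (2 * C) = (2 / (L : ℝ)) * (C * (L : ℝ)⁻¹) by field_simp]
        have h2 : 2 / (L : ℝ) ≤ 1 := (div_le_one hL0).mpr h2L
        calc 2 / (L : ℝ) * (C * (L : ℝ)⁻¹) ≤ 1 * (C * (L : ℝ)⁻¹) :=
              mul_le_mul_of_nonneg_right h2 (by positivity)
          _ = C * (L : ℝ)⁻¹ := one_mul _
          _ ≤ C * θ := mul_le_mul_of_nonneg_left hθL hC.le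
      calc ((L : ℝ) ^ 2)⁻¹ * (C * θ ^ K * F + Cr * latticeConst (d + 1) κ * θ ^ K * F)
          ≤ ((L : ℝ) ^ 2)⁻¹ * (2 * C * (θ ^ K * F)) := mul_le_mul_of_nonneg_left hstep1 (by positivity)
        _ = ((L : ℝ) ^ 2)⁻¹ * (2 * C) * (θ ^ K * F) := by ring
        _ ≤ C * θ * (θ ^ K * F) := mul_le_mul_of_nonneg_right hstep2 (by positivity)
        _ = C * θ ^ (K + 1) * F := by rw [pow_succ]; ring
    -- assemble (the calc is written in the peel's spelling; the goal's `L^(K+1)`, `M_e` is the same term)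
    have hL2i : (0 : ℝ) ≤ ((L : ℝ) ^ 2)⁻¹ := by positivity
    calc |∑ y'' : Tor (fine (L ^ n * L ^ (K + 1)) (ksM L i)),
            ((((L ^ n * L ^ (K + 1) : ℕ) : ℝ) ^ (d + 1))⁻¹ *
              (constrainedProp (L ^ n * L ^ (K + 1)) (ksM L i) (aK a L (K + 1 + n))
                  (((L ^ n * L ^ (K + 1) : ℕ) : ℝ) ^ 2) msq
                  (torCongr h (flatten (L ^ n * L ^ K) L (ksM L i) x')) y''
                - constrainedProp (L ^ K * L) (ksM L i) (aK a L (K + 1)) (((L ^ K * L : ℕ) : ℝ) ^ 2) msq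
                  (underPtN L (K + 1) n (ksM L i) (torCongr h (flatten (L ^ n * L ^ K) L (ksM L i) x')))
                  (underPtN L (K + 1) n (ksM L i) y''))
              * f'' y'')|
        = ((L : ℝ) ^ 2)⁻¹ *
          |∑ y', w * (constrainedProp (L ^ n * L ^ K) (ksU L i) (aK a L (K + n)) (((L ^ n * L ^ K : ℕ) : ℝ) ^ 2)
              (msq / (L : ℝ) ^ 2) x' y'
            - constrainedProp (L ^ K) (ksU L i) (aK a L K) (((L ^ K : ℕ) : ℝ) ^ 2) (msq / (L : ℝ) ^ 2)
              (underPtN L K n (ksU L i) x') (underPtN L K n (ksU L i) y'))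
            * f'' (torCongr h (flatten (L ^ n * L ^ K) L (ksM L i) y'))
          + ∑ y', w * (ksSlice' L a (msq / (L : ℝ) ^ 2) i x' y'
            - ksSlice L a (msq / (L : ℝ) ^ 2) i (underPtN L K n (ksU L i) x') (underPtN L K n (ksU L i) y'))
            * f'' (torCongr h (flatten (L ^ n * L ^ K) L (ksM L i) y'))| := by
          rw [hpeel, hsum, abs_mul, abs_of_nonneg hL2i]
      _ ≤ ((L : ℝ) ^ 2)⁻¹ * (C * θ ^ K * F + Cr * latticeConst (d + 1) κ * θ ^ K * F) :=
          mul_le_mul_of_nonneg_left ((abs_add_le _ _).trans (add_le_add hIH hS)) hL2i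
      _ ≤ C * θ ^ (K + 1) * F := hgain

end Summit.QuantumFields.YangMills.BalabanUVNodes.N15KingModelRung.Curved
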